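import Summits.KontsevichZagierPeriods.KontsevichZagierPeriods.Theses.SymplecticScissors
import Summits.KontsevichZagierPeriods.KontsevichZagierPeriods.Theses.InequalityCost
import Literature.NumberTheory.Transcendental.KZProductIdeal
import Literature.NumberTheory.Transcendental.KZCalculusProofs

/-!
# Sketch — crux-ideate `stmt-KontsevichZagierPeriods-3814` (`SymplecticScissors.VolumeForm`),
ideator 2, round 1

First lemmas of the three crux idea cards filed from this folder:

* card `symmetry-descent`      : `RevolutionDescent`, `RevolutionSandwich`, `ConeDescentIff`,
                                 `BidiscTwoBalls`, `revolutionLayer3_of` (statement shapes);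
* card `frame-normalisation`   : `VolumeFormAt`, `volumeForm_iff_forall` (proved),
                                 `volumeFormAt_of_succ` (PROVED: the frame is monotone in `N`),
                                 `TailCompression`, `volumeForm_of_tame` (PROVED modulo the two
                                 named hypotheses: bounded frame `TameVolumeKernel` = stmt-8986);
* card `product-layer-dichotomy`: `ProductGlueLin`, `QuadraticLeaf`, `productLayer_of` (proved,
                                 pure logic).

Everything is stated over existing declarations (`KZ.IntegralRep`, `KZ.Equivalent`,
`KZ.relations`, `KZ.of`, `KZ.piRep`, `KZ.PiCancellation`, `IntegralRep.slab`,
`IntegralRep.prodDomain`, route decls `SymplecticScissors.VolumeForm / PlanarAreas`,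
`InequalityCost.TameVolumeKernel`). No new axioms; `sorry` only where marked (none in proofs of
the claims called PROVED).
-/

noncomputable section

open Set MeasureTheory
open Literature.NumberTheory.Transcendental
open Literature.NumberTheory.Transcendental.KZ

namespace Summit.KontsevichZagierPeriods.KontsevichZagierPeriods.Cruxes.VolumeForm.SketchIdeator2

open Summit.KontsevichZagierPeriods.KontsevichZagierPeriods.Theses

/-! ## The frame, one dimension at a time -/

/-- The frame `VolumeForm` at a fixed dimension `N`. -/
def VolumeFormAt (N : ℕ) : Prop :=
  ∀ (r r' : IntegralRep N), (∀ x ∈ r.domain, r.integrand x = 1) →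
    (∀ x ∈ r'.domain, r'.integrand x = 1) → r.value = r'.value → Equivalent r r'

/-- `VolumeForm ↔ ∀ N, VolumeFormAt N` (bookkeeping). -/
theorem volumeForm_iff_forall : SymplecticScissors.VolumeForm ↔ ∀ N, VolumeFormAt N := by
  constructor
  · intro h N r r' hr hr' hv
    exact h r r' hr hr' hv
  · intro h N r r' hr hr' hv
    exact h N r r' hr hr' hv

/-- **Ladder (PROVED).** The frame is monotone in the dimension: `VolumeFormAt (N+1) → VolumeFormAt N`.
Proof: thicken both sets to slabs `A × [0,1]`, `B × [0,1]` (one Newton–Leibniz move each,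
`IntegralRep.equivalent_slab`), apply the frame one dimension up, come back. Hence
`VolumeForm ↔ ∀ N ≥ N₀, VolumeFormAt N` for every `N₀`: the frame is an `N → ∞` statement and every
layer route may state its layer in any convenient ambient dimension. -/
theorem volumeFormAt_of_succ {N : ℕ} (h : VolumeFormAt (N + 1)) : VolumeFormAt N := by
  intro r r' hr hr' hv
  have h1 : ∀ x ∈ (r.slab 0).domain, (r.slab 0).integrand x = 1 := by
    intro z hz
    simp only [IntegralRep.integrand_slab]
    exact hr _ hz.1
  have h1' : ∀ x ∈ (r'.slab 0).domain, (r'.slab 0).integrand x = 1 := by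
    intro z hz
    simp only [IntegralRep.integrand_slab]
    exact hr' _ hz.1
  have hv' : (r.slab 0).value = (r'.slab 0).value := by
    rw [← KZ.Equivalent.value_eq_holds (r.equivalent_slab 0),
      ← KZ.Equivalent.value_eq_holds (r'.equivalent_slab 0), hv]
  exact ((r.equivalent_slab 0).trans (h _ _ h1 h1' hv')).trans (r'.equivalent_slab 0).symm

/-! ## Card `frame-normalisation`: bounded domains suffice (tail compression) -/

/-- **Tail compression** (the one geometric stub of card `frame-normalisation`): every finite-volume
`ℚ`-semialgebraic set is KZ-equivalent, inside the calculus, to a BOUNDED integrand-1 set of the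
SAME dimension (cylindrical decomposition at infinity + monomial compressions
`(x, y) ↦ (x^{-α}, y·x^{α+1}/α)`, `|det| = 1`, on each unbounded cell of finite volume; near
finite singular points of the profile the same with `(u, t) ↦ (u^{1-γ}/(1-γ), t·u^{γ})`). -/
def TailCompression : Prop :=
  ∀ (N : ℕ) (r : IntegralRep N), (∀ x ∈ r.domain, r.integrand x = 1) →
    ∃ (M : ℕ) (r' : IntegralRep N), (∀ x ∈ r'.domain, r'.integrand x = 1) ∧
      (∀ x ∈ r'.domain, ∀ i, |x i| ≤ M) ∧ Equivalent r r'

/-- **Frame merge (PROVED modulo the two named hypotheses).** The bounded frame of route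
InequalityCost (`TameVolumeKernel`, stmt-8986) plus tail compression gives the full frame
`VolumeForm` (stmt-3814): the two frame items of the ledger are one statement. -/
theorem volumeForm_of_tame (hT : TailCompression) (hK : InequalityCost.TameVolumeKernel) :
    SymplecticScissors.VolumeForm := by
  intro N r r' hr hr' hv
  obtain ⟨M, s, hs1, hsM, hrs⟩ := hT N r hr
  obtain ⟨M', s', hs1', hsM', hrs'⟩ := hT N r' hr'
  have hvs : s.value = s'.value := by
    rw [← KZ.Equivalent.value_eq_holds hrs, ← KZ.Equivalent.value_eq_holds hrs', hv]
  have hbs : ∀ x ∈ s.domain, ∀ i, |x i| ≤ ((max M M' : ℕ) : ℝ) := by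
    intro x hx i
    exact (hsM x hx i).trans (by exact_mod_cast le_max_left M M')
  have hbs' : ∀ x ∈ s'.domain, ∀ i, |x i| ≤ ((max M M' : ℕ) : ℝ) := by
    intro x hx i
    exact (hsM' x hx i).trans (by exact_mod_cast le_max_right M M')
  have hss' : Equivalent s s' :=
    hK (max M M') s s' hbs (fun x hx => by simpa using hs1 x hx) hbs'
      (fun x hx => by simpa using hs1' x hx) hvs
  exact (hrs.trans hss').trans hrs'.symm

/-- **Bounded difference** — the weaker, IN-PRINT form of the compression stub actually needed for the
merge (Viu-Sos, arXiv:1509.01097, Thm 1.1 with §2.2 projective charts and §2.3 resolution of the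
chart poles, "algorithmically and respecting the KZ-rules"): every integrand-1 class is a DIFFERENCE of
two bounded integrand-1 classes of one common dimension. -/
def BoundedDifference : Prop :=
  ∀ (N : ℕ) (r : IntegralRep N), (∀ x ∈ r.domain, r.integrand x = 1) →
    ∃ (M B : ℕ) (K₁ K₂ : IntegralRep M), (∀ x ∈ K₁.domain, K₁.integrand x = 1) ∧
      (∀ x ∈ K₂.domain, K₂.integrand x = 1) ∧ (∀ x ∈ K₁.domain, ∀ i, |x i| ≤ B) ∧
      (∀ x ∈ K₂.domain, ∀ i, |x i| ≤ B) ∧ of r - (of K₁ - of K₂) ∈ relations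

/-- **Bounded gluing** (bookkeeping, provable now from `IntegralRep.slab`, translations (rule 2) and
`domainAddRel`): two pairs of bounded integrand-1 sets are merged crosswise into two bounded
integrand-1 sets of a common dimension. -/
def BoundedGlue : Prop :=
  ∀ (M M' B : ℕ) (K₁ K₂ : IntegralRep M) (K₁' K₂' : IntegralRep M'),
    (∀ x ∈ K₁.domain, K₁.integrand x = 1) → (∀ x ∈ K₂.domain, K₂.integrand x = 1) →
    (∀ x ∈ K₁'.domain, K₁'.integrand x = 1) → (∀ x ∈ K₂'.domain, K₂'.integrand x = 1) →
    (∀ x ∈ K₁.domain, ∀ i, |x i| ≤ B) → (∀ x ∈ K₂.domain, ∀ i, |x i| ≤ B) →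
    (∀ x ∈ K₁'.domain, ∀ i, |x i| ≤ B) → (∀ x ∈ K₂'.domain, ∀ i, |x i| ≤ B) →
    ∃ (L C : ℕ) (S S' : IntegralRep L), (∀ x ∈ S.domain, S.integrand x = 1) ∧
      (∀ x ∈ S'.domain, S'.integrand x = 1) ∧ (∀ x ∈ S.domain, ∀ i, |x i| ≤ C) ∧
      (∀ x ∈ S'.domain, ∀ i, |x i| ≤ C) ∧
      of S - (of K₁ + of K₂') ∈ relations ∧ of S' - (of K₁' + of K₂) ∈ relations

/-- **Frame merge, difference form (PROVED modulo the three named hypotheses):** Viu-Sos' bounded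
difference + gluing bookkeeping + the bounded frame `TameVolumeKernel` (stmt-8986) ⟹ `VolumeForm`. -/
theorem volumeForm_of_tame' (hD : BoundedDifference) (hG : BoundedGlue)
    (hK : InequalityCost.TameVolumeKernel) : SymplecticScissors.VolumeForm := by
  intro N r r' hr hr' hv
  obtain ⟨M, B, K₁, K₂, h1, h2, hb1, hb2, hrel⟩ := hD N r hr
  obtain ⟨M', B', K₁', K₂', h1', h2', hb1', hb2', hrel'⟩ := hD N r' hr'
  have c1 : ∀ x ∈ K₁.domain, ∀ i, |x i| ≤ ((max B B' : ℕ) : ℝ) := fun x hx i =>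
    (hb1 x hx i).trans (by exact_mod_cast le_max_left B B')
  have c2 : ∀ x ∈ K₂.domain, ∀ i, |x i| ≤ ((max B B' : ℕ) : ℝ) := fun x hx i =>
    (hb2 x hx i).trans (by exact_mod_cast le_max_left B B')
  have c1' : ∀ x ∈ K₁'.domain, ∀ i, |x i| ≤ ((max B B' : ℕ) : ℝ) := fun x hx i =>
    (hb1' x hx i).trans (by exact_mod_cast le_max_right B B')
  have c2' : ∀ x ∈ K₂'.domain, ∀ i, |x i| ≤ ((max B B' : ℕ) : ℝ) := fun x hx i =>
    (hb2' x hx i).trans (by exact_mod_cast le_max_right B B')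
  obtain ⟨L, C, S, S', hS1, hS'1, hSb, hS'b, hS, hS'⟩ :=
    hG M M' (max B B') K₁ K₂ K₁' K₂' h1 h2 h1' h2' c1 c2 c1' c2'
  have key : of r - of r' - (of S - of S') ∈ relations := by
    have e : of r - of r' - (of S - of S') =
        (of r - (of K₁ - of K₂)) - (of r' - (of K₁' - of K₂')) - (of S - (of K₁ + of K₂')) +
          (of S' - (of K₁' + of K₂)) := by abel
    rw [e]
    exact relations.add_mem (relations.sub_mem (relations.sub_mem hrel hrel') hS) hS'
  have hval : S.value = S'.value := by
    have h0 : eval (of r - of r' - (of S - of S')) = 0 :=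
      AddMonoidHom.mem_ker.mp (relations_le_ker_eval_holds key)
    simp only [map_sub, eval_of] at h0
    linarith
  have hSS' : Equivalent S S' :=
    hK C S S' hSb (fun x hx => by simpa using hS1 x hx) hS'b (fun x hx => by simpa using hS'1 x hx) hval
  have e2 : of r - of r' = (of r - of r' - (of S - of S')) + (of S - of S') := by abel
  show of r - of r' ∈ relations
  rw [e2]
  exact relations.add_mem key hSS'

/-! ## Card `symmetry-descent`: descent of the frame along algebraic symmetries -/

/-- The profile point of `z ∈ ℝ^{2+m}` under the rotation in the two leading coordinates:
`(u, w) = ((z₀² + z₁²)/2, z₂, …)` — Archimedes' coordinate `u = r²/2` (`dx dy = du dθ`). -/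
def profilePt (m : ℕ) (z : Fin (2 + m) → ℝ) : Fin (1 + m) → ℝ :=
  Fin.append (fun _ : Fin 1 => ((z (Fin.castAdd m 0)) ^ 2 + (z (Fin.castAdd m 1)) ^ 2) / 2)
    (fun j : Fin m => z (Fin.natAdd 2 j))

/-- The solid of revolution (`T¹`-spin in the two leading coordinates) with profile `P ⊆ ℝ^{1+m}`. -/
def revolve (m : ℕ) (P : Set (Fin (1 + m) → ℝ)) : Set (Fin (2 + m) → ℝ) :=
  {z | profilePt m z ∈ P}

/-- **Revolution descent** (stub 1 of card `symmetry-descent`, provable now): equivalent profiles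
spin to equivalent solids. Mechanism: on `{z₀ > 0}` and `{z₀ < 0}` the chart
`(z₀, z₁, w) ↦ (s, t, w) = (z₁/z₀, z₀²/2, w)` has `|det| = 1` (= `DiscSectorOneLine`, proved) and
carries `revolve P` onto `{(s,t,w) : (t(1+s²), w) ∈ P}`; the shear `(s,t,w) ↦ (s, t(1+s²), w)`
(Jacobian `1+s²`, rule 2 with integrand) turns it into `[ℝ × P, (1+s²)⁻¹] = [X] * [P]` with
`X = (ℝ, (1+s²)⁻¹)` (value `π`); so `[revolve P] − 2·[X]*[P] ∈ relations`, and `[X] * ·`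
preserves relations (`KZ.of_mul_mem_relations`, landed). -/
def RevolutionDescent : Prop :=
  ∀ (m : ℕ) (P Q : IntegralRep (1 + m)) (A B : IntegralRep (2 + m)),
    (∀ w ∈ P.domain, P.integrand w = 1) → (∀ w ∈ Q.domain, Q.integrand w = 1) →
    (∀ z ∈ A.domain, A.integrand z = 1) → (∀ z ∈ B.domain, B.integrand z = 1) →
    A.domain = revolve m P.domain → B.domain = revolve m Q.domain →
    Equivalent P Q → Equivalent A B

/-- The carrier identity behind the descent: `[revolve P] ≡ 2·[X]*[P]` for a 1-dimensional
integrand-`(1+s²)⁻¹` carrier `X` of value `π` (two charts `z₀ ≷ 0`). -/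
def RevolveCarrier : Prop :=
  ∃ X : IntegralRep 1, X.value = Real.pi ∧
    ∀ (m : ℕ) (P : IntegralRep (1 + m)) (A : IntegralRep (2 + m)),
      (∀ w ∈ P.domain, P.integrand w = 1) → (∀ z ∈ A.domain, A.integrand z = 1) →
      A.domain = revolve m P.domain → of A - 2 • (of X * of P) ∈ relations

/-- The axially symmetric LAYER of the frame in dimension `2 + m`: volume is the only KZ-invariant of
`ℚ`-semialgebraic solids of revolution. -/
def RevolutionFormAt (m : ℕ) : Prop :=
  ∀ (P Q : IntegralRep (1 + m)) (A B : IntegralRep (2 + m)),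
    (∀ w ∈ P.domain, P.integrand w = 1) → (∀ w ∈ Q.domain, Q.integrand w = 1) →
    (∀ z ∈ A.domain, A.integrand z = 1) → (∀ z ∈ B.domain, B.integrand z = 1) →
    A.domain = revolve m P.domain → B.domain = revolve m Q.domain →
    A.value = B.value → Equivalent A B

/-- **Pappus layer (proved shape, pure logic from the descent):** the frame one dimension DOWN gives
the axially symmetric layer one dimension UP. With `m = 1`: `PlanarAreas` (stmt-4990, HW-level)
⟹ "two ℚ-semialgebraic solids of revolution in ℝ³ of equal volume are KZ-equivalent". -/
theorem revolutionFormAt_of (hD : RevolutionDescent)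
    (hval : ∀ (m : ℕ) (P : IntegralRep (1 + m)) (A : IntegralRep (2 + m)),
      (∀ w ∈ P.domain, P.integrand w = 1) → (∀ z ∈ A.domain, A.integrand z = 1) →
      A.domain = revolve m P.domain → A.value = 2 * Real.pi * P.value)
    {m : ℕ} (hF : VolumeFormAt (1 + m)) : RevolutionFormAt m := by
  intro P Q A B hP hQ hA hB hAd hBd hv
  refine hD m P Q A B hP hQ hA hB hAd hBd (hF P Q hP hQ ?_)
  have hA' := hval m P A hP hA hAd
  have hB' := hval m Q B hQ hB hBd
  have h2pi : (2 * Real.pi) ≠ 0 := by positivity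
  exact mul_left_cancel₀ h2pi (by rw [← hA', ← hB', hv])

/-- `PlanarAreas` is literally the frame at `N = 2`. -/
theorem volumeFormAt_two_iff : VolumeFormAt 2 ↔ SymplecticScissors.PlanarAreas := Iff.rfl

/-- **The sandwich (exact converse obstruction):** the axially symmetric layer in dimension `2 + m`
gives back the frame in dimension `1 + m` (for profiles in the open half-space `u > 0`, where every
finite-volume set can be translated) PROVIDED `[π]` cancels: `PiCancellation` (AyoubSpecialisation
item 0540, `KZ.PiCancellation`) is exactly the descent obstruction. Provable now from
`RevolveCarrier`, torsion-freeness (landed) and `[X] ~ [π]` (KZ's own chain, landed pieces). -/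
def RevolutionSandwich : Prop :=
  PiCancellation → ∀ (m : ℕ), RevolutionFormAt m →
    ∀ (P Q : IntegralRep (1 + m)), (∀ w ∈ P.domain, P.integrand w = 1) →
      (∀ w ∈ Q.domain, Q.integrand w = 1) →
      (∀ w ∈ P.domain, 0 < w (Fin.castAdd m 0)) → (∀ w ∈ Q.domain, 0 < w (Fin.castAdd m 0)) →
      P.value = Q.value → Equivalent P Q

/-- The cone point `x = y / t` of `z = (y, t) ∈ ℝ^{N} × (0,1)`. -/
def conePt (N : ℕ) (z : Fin (N + 1) → ℝ) : Fin N → ℝ :=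
  fun i => z (Fin.castSucc i) / z (Fin.last N)

/-- The open cone `{(t·x, t) : x ∈ P, 0 < t < 1}` over `P ⊆ ℝ^N`. -/
def cone (N : ℕ) (P : Set (Fin N → ℝ)) : Set (Fin (N + 1) → ℝ) :=
  {z | 0 < z (Fin.last N) ∧ z (Fin.last N) < 1 ∧ conePt N z ∈ P}

/-- **Cone descent is EXACT** (stub 2 of card `symmetry-descent`, provable now): the map
`(x, t) ↦ (t·x, t)` has Jacobian `t^N`, so `[cone P] ≡ [P × (0,1), t^N] ≡ (1/(N+1))·[P]` by ONE
Newton–Leibniz move with the POLYNOMIAL primitive `t^{N+1}/(N+1)`; division by `N + 1` is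
torsion-freeness (landed). No `π`, no cancellation conjecture: cones over `N`-sets are the frame at
`N` verbatim, one dimension up. -/
def ConeDescentIff : Prop :=
  ∀ (N : ℕ) (P Q : IntegralRep N) (A B : IntegralRep (N + 1)),
    (∀ x ∈ P.domain, P.integrand x = 1) → (∀ x ∈ Q.domain, Q.integrand x = 1) →
    (∀ z ∈ A.domain, A.integrand z = 1) → (∀ z ∈ B.domain, B.integrand z = 1) →
    A.domain = cone N P.domain → B.domain = cone N Q.domain →
    (Equivalent P Q ↔ Equivalent A B)

/-- The unit bidisc `D × D ⊆ ℝ⁴` (value `π²`; route SphericalSchlafli's target `[π]·[π]`). -/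
def bidisc : Set (Fin 4 → ℝ) := {z | z 0 ^ 2 + z 1 ^ 2 < 1 ∧ z 2 ^ 2 + z 3 ^ 2 < 1}

/-- The unit 4-ball (value `π²/2`) and a disjoint translate. -/
def ball4 : Set (Fin 4 → ℝ) := {z | z 0 ^ 2 + z 1 ^ 2 + z 2 ^ 2 + z 3 ^ 2 < 1}

/-- A translate of the unit 4-ball, disjoint from `ball4`. -/
def ball4' : Set (Fin 4 → ℝ) := {z | (z 0 - 3) ^ 2 + z 1 ^ 2 + z 2 ^ 2 + z 3 ^ 2 < 1}

/-- **Calibration (provable now, rules 1a + 2 only): the bidisc is two 4-balls.** Both are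
`T²`-invariant; in Archimedes coordinates `uⱼ = |zⱼ|²/2` the moment images are the square
`(0,½)²` and the triangle `{u₁+u₂ < ½}`; the square is the triangle plus its reflection
`u ↦ (½,½) − u`, which lifts to the `T²`-equivariant volume-preserving semialgebraic map
`zⱼ ↦ zⱼ·√((1 − |zⱼ|²)/|zⱼ|²)` carrying `D×D ∖ B⁴` onto `B⁴` (a.e.). -/
def BidiscTwoBalls : Prop :=
  ∀ (r s : IntegralRep 4), r.domain = bidisc → s.domain = ball4 ∪ ball4' →
    (∀ z ∈ r.domain, r.integrand z = 1) → (∀ z ∈ s.domain, s.integrand z = 1) → Equivalent r s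

/-! ## Card `product-layer-dichotomy`: the Künneth layer of the frame -/

/-- The product layer of the frame at `N = p + q`: products of integrand-1 sets. -/
def ProductLayerAt (p q : ℕ) : Prop :=
  ∀ (P P' : IntegralRep p) (Q Q' : IntegralRep q) (A B : IntegralRep (p + q)),
    (∀ x ∈ P.domain, P.integrand x = 1) → (∀ x ∈ P'.domain, P'.integrand x = 1) →
    (∀ x ∈ Q.domain, Q.integrand x = 1) → (∀ x ∈ Q'.domain, Q'.integrand x = 1) →
    (∀ z ∈ A.domain, A.integrand z = 1) → (∀ z ∈ B.domain, B.integrand z = 1) →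
    A.domain = IntegralRep.prodDomain P Q → B.domain = IntegralRep.prodDomain P' Q' →
    A.value = B.value → Equivalent A B

/-- The LINEARLY GENERATED case: the ratio of the first factors is a real algebraic number
(decidable for planar factors by Sertöz–Ouaknine–Worrell). -/
def LinCase {p : ℕ} (P P' : IntegralRep p) : Prop :=
  ∃ l : ℝ, 0 < l ∧ IsAlgebraic ℚ l ∧ P.value = l * P'.value

/-- **Product glue in the linearly generated case** (stub of card `product-layer-dichotomy`,
provable now from the lower frames): stretch `P'` by `λ` and `Q` by `λ` in one coordinate
(rule 2 realises `m_λ` on sets), use `VolumeFormAt p`, `VolumeFormAt q` on the two factor pairs,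
the ideal property of `relations` under products (landed) and the linear map
`diag(λ⁻¹, 1, …, λ, 1, …)` of determinant 1: NO cancellation of a period is ever needed. -/
def ProductGlueLin (p q : ℕ) : Prop :=
  VolumeFormAt p → VolumeFormAt q →
    ∀ (P P' : IntegralRep p) (Q Q' : IntegralRep q) (A B : IntegralRep (p + q)),
      (∀ x ∈ P.domain, P.integrand x = 1) → (∀ x ∈ P'.domain, P'.integrand x = 1) →
      (∀ x ∈ Q.domain, Q.integrand x = 1) → (∀ x ∈ Q'.domain, Q'.integrand x = 1) →
      (∀ z ∈ A.domain, A.integrand z = 1) → (∀ z ∈ B.domain, B.integrand z = 1) →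
      A.domain = IntegralRep.prodDomain P Q → B.domain = IntegralRep.prodDomain P' Q' →
      A.value = B.value → LinCase P P' → Equivalent A B

/-- **The residual leaf: genuinely quadratic relations.** Products of equal total volume whose
first factors have a TRANSCENDENTAL ratio (Legendre's relation `K(2E − K) = π/2` at `k² = ½` is
the first instance for `p = q = 2`). -/
def QuadraticLeaf (p q : ℕ) : Prop :=
  ∀ (P P' : IntegralRep p) (Q Q' : IntegralRep q) (A B : IntegralRep (p + q)),
    (∀ x ∈ P.domain, P.integrand x = 1) → (∀ x ∈ P'.domain, P'.integrand x = 1) →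
    (∀ x ∈ Q.domain, Q.integrand x = 1) → (∀ x ∈ Q'.domain, Q'.integrand x = 1) →
    (∀ z ∈ A.domain, A.integrand z = 1) → (∀ z ∈ B.domain, B.integrand z = 1) →
    A.domain = IntegralRep.prodDomain P Q → B.domain = IntegralRep.prodDomain P' Q' →
    A.value = B.value → ¬ LinCase P P' → Equivalent A B

/-- **Dichotomy (PROVED, pure logic):** the product layer splits by excluded middle on `LinCase`. -/
theorem productLayer_of {p q : ℕ} (hlin : ProductGlueLin p q) (hquad : QuadraticLeaf p q)
    (hp : VolumeFormAt p) (hq : VolumeFormAt q) : ProductLayerAt p q := by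
  intro P P' Q Q' A B h1 h2 h3 h4 h5 h6 hA hB hv
  by_cases hc : LinCase P P'
  · exact hlin hp hq P P' Q Q' A B h1 h2 h3 h4 h5 h6 hA hB hv hc
  · exact hquad P P' Q Q' A B h1 h2 h3 h4 h5 h6 hA hB hv hc

/-- The frame trivially contains its product layers (sanity: the leaf is not stronger than the crux). -/
theorem productLayerAt_of_volumeFormAt {p q : ℕ} (h : VolumeFormAt (p + q)) : ProductLayerAt p q :=
  fun _ _ _ _ A B _ _ _ _ h5 h6 _ _ hv => h A B h5 h6 hv

end Summit.KontsevichZagierPeriods.KontsevichZagierPeriods.Cruxes.VolumeForm.SketchIdeator2
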